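import Literature.Computability.FineGrained.PPSZModify
import Mathlib.Algebra.Group.Action.Defs
import HarnessLib

/-!
# PPSZ II: critical clause trees, implicitly — cut events and the forcing lemma

Topic `Literature/Computability/FineGrained`, second file of the line `PPSZ*` (Paturi–Pudlák–
Saks–Zane 2005 with Hertli's `D`-implication, see `PPSZModify.lean`).

PPSZ lower-bound the probability that a variable `v` is forced through a *critical clause tree*
for `v` (Def. 1, §3.1): a labelled rooted tree such that for every *cut* `A` the formula
contains a critical clause for `v` on the variables `var(A) ∪ {v}`; Lemma 4 / Lemma 11 grow
such a tree of depth `d` inside the `k^d`-bounded resolution closure, and Lemma 6 observes that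
`v` is forced as soon as all variables of some cut precede `v`. With `D`-implication the
resolution bookkeeping disappears and the whole construction becomes a recursion on the set `P`
of labels on the path from the root (this file; no tree datatype is needed):

* the growing rule (Lemma 11): at a node whose root path carries the labels `P` (nondefining
  variables only, `v ∈ P`), take a clause `pick P` of `G` falsified by `z ⊕ P` (it exists
  because `z` is the only satisfying assignment of the subcube); its variables outside `P` label
  the children (`children`), of which there are at most `k - 1`; children labelled by defining
  variables are leaves, the others are grown to the remaining depth;
* `cutEvent d P α a` (the event `Cut_T(a)` of §3.3 for the subtree of remaining depth `d`):
  every child `w` is placed before `a` (`α w < a`) or is nondefining and its own subtree has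
  such a cut; `clausesOf d P`: the clauses picked in that subtree, at most `(3^d-1)/2` of them
  for `k = 4` (`length_clausesOf_le`);
* `sat_clausesOf_forces` (the semantic core of Lemmas 4/11, replacing resolution): if the cut
  event holds, every assignment satisfying the picked clauses and agreeing with `z` on the
  variables placed before `a` agrees with `z` on some variable of `P`;
* `isForced_of_cutEvent` (**Lemma 6** with Lemma 11): at the root (`P = {v}`, `a = α v`), if
  all variables placed before `α v` precede `v` in the processing order, the cut event makes
  `v` forced for `(G, ord, z)` with implication bound `D ≥ (3^d-1)/2`.

Also: the cut event is monotone (a down-set in `α`, `cutEvent_mono`), increasing in `a`, and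
independent of the placements of the path variables (`cutEvent_congr`), the three properties
the probability estimate (`PPSZRecursion.lean`) uses.

## References

* R. Paturi, P. Pudlák, M. E. Saks, F. Zane, *An improved exponential-time algorithm for
  k-SAT*, J. ACM 52(3) (2005) 337–364, §3.1 Def. 1 (critical clause trees), Lemma 4 and §3.2
  (growing the tree), §3.3 Lemma 6 (cuts force), §4.2 Lemma 11 (trees uniform w.r.t. the
  nondefining variables). [key `PaturiPudlakSaksZane2005`]
* T. Hertli, SIAM J. Comput. 43 (2014), §2 Def. 3 (`s`-implication). [key `Hertli2014`]
-/

namespace Literature.Computability.FineGrained.PPSZ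

variable {V : Type*} [DecidableEq V]

/-! ### Flipping a set of variables; the variables of a clause -/

/-- `z ⊕ P`: the assignment `z` with the variables of `P` complemented. [cite: PaturiPudlakSaksZane2005, §3.2 (notation z ⊕ U)] -/
def flip (z : V → Bool) (P : Finset V) : V → Bool := fun w => if w ∈ P then !z w else z w

/-- The set of variables of a clause. [folklore] -/
def cvars (C : List (V × Bool)) : Finset V := (C.map Prod.fst).toFinset

omit [DecidableEq V] in
/-- A clause satisfied by `z` but not by `b` contains a variable on which they differ. [folklore] -/
theorem exists_mem_ne_of_satClause {z b : V → Bool} {C : List (V × Bool)} (hz : SatClause z C)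
    (hb : ¬ SatClause b C) : ∃ l ∈ C, b l.1 ≠ z l.1 := by
  obtain ⟨l, hl, hzl⟩ := hz
  refine ⟨l, hl, fun h => hb ⟨l, hl, ?_⟩⟩
  rw [h, hzl]

omit [DecidableEq V] in
/-- Two assignments agreeing on the variables of a clause satisfy it alike. [folklore] -/
theorem satClause_congr {b b' : V → Bool} {C : List (V × Bool)} (h : ∀ l ∈ C, b l.1 = b' l.1) :
    SatClause b C ↔ SatClause b' C := by
  unfold SatClause
  constructor
  · rintro ⟨l, hl, hbl⟩; exact ⟨l, hl, by rw [← h l hl, hbl]⟩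
  · rintro ⟨l, hl, hbl⟩; exact ⟨l, hl, by rw [h l hl, hbl]⟩

/-! ### The growing rule -/

section Grow

variable (G : CNF V) (z : V → Bool) (Dset : Finset V)

/-- A *clause picker* for `(G, z, Dset)`: for every nonempty set `P` of nondefining variables a
clause of `G` that is falsified by `z ⊕ P` — the clause `C_i` "not satisfied by `z ⊕ var(P_i)`"
used to expand a leaf in the proof of Lemma 4 / Lemma 11. [cite: PaturiPudlakSaksZane2005, §3.2 (proof of Lemma 4) and Lemma 11] -/
structure Picker where
  /-- the clause chosen for the path label set `P` -/
  pick : Finset V → List (V × Bool)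
  /-- it is a clause of `G` … -/
  pick_mem : ∀ P : Finset V, P.Nonempty → Disjoint P Dset → pick P ∈ G
  /-- … falsified by `z ⊕ P` -/
  not_sat_pick : ∀ P : Finset V, P.Nonempty → Disjoint P Dset → ¬ SatClause (flip z P) (pick P)

/-- **Existence of a picker (the hypothesis of Lemma 11).** If `z` satisfies `G` and is the only
satisfying assignment agreeing with `z` on `Dset` (i.e. the only one in the subcube `B` with
defining variables `Dset`), then flipping any nonempty set of nondefining variables falsifies
some clause. [cite: PaturiPudlakSaksZane2005, §4.2 (before Lemma 11)] -/
theorem nonempty_picker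
    (huniq : ∀ y : V → Bool, Sat y G → (∀ w ∈ Dset, y w = z w) → y = z) :
    Nonempty (Picker G z Dset) := by
  classical
  have key : ∀ P : Finset V, P.Nonempty → Disjoint P Dset → ∃ C ∈ G, ¬ SatClause (flip z P) C := by
    intro P hP hPD
    by_contra h
    push Not at h
    have hflip : flip z P = z := huniq _ (fun C hC => h C hC) fun w hw => by
      have : w ∉ P := fun hwP => (Finset.disjoint_left.1 hPD hwP) hw
      simp [flip, this]
    obtain ⟨w, hw⟩ := hP
    have := congr_fun hflip w
    simp [flip, hw] at this
  refine ⟨⟨fun P => if h : P.Nonempty ∧ Disjoint P Dset then (key P h.1 h.2).choose else [],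
    fun P hP hPD => ?_, fun P hP hPD => ?_⟩⟩
  · rw [dif_pos ⟨hP, hPD⟩]; exact (key P hP hPD).choose_spec.1
  · rw [dif_pos ⟨hP, hPD⟩]; exact (key P hP hPD).choose_spec.2

namespace Picker

variable {G z Dset} (pk : Picker G z Dset)

/-- The labels of the children of a node with root-path label set `P`: the variables of the
picked clause that are not on the path. [cite: PaturiPudlakSaksZane2005, §3.2 (proof of Lemma 4: "for each variable w of var(C_i) − var(P_i) give b_i a child labeled w")] -/
def children (P : Finset V) : Finset V := cvars (pk.pick P) \ P

/-- Children are never path variables (so labels on a root path are distinct: admissibility).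
[cite: PaturiPudlakSaksZane2005, Def. 1 (admissible trees)] -/
theorem disjoint_children (P : Finset V) : Disjoint (pk.children P) P :=
  Finset.sdiff_disjoint

/-- The picked clause of a nonempty nondefining path set has a variable on the path (it is
satisfied by `z` — which satisfies `G` — but not by `z ⊕ P`). [cite: PaturiPudlakSaksZane2005, §3.2] -/
theorem exists_mem_pick_mem (hz : Sat z G) {P : Finset V} (hP : P.Nonempty) (hPD : Disjoint P Dset) :
    ∃ l ∈ pk.pick P, l.1 ∈ P := by
  obtain ⟨l, hl, hne⟩ := exists_mem_ne_of_satClause (hz _ (pk.pick_mem P hP hPD))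
    (pk.not_sat_pick P hP hPD)
  refine ⟨l, hl, ?_⟩
  by_contra h
  simp [flip, h] at hne

/-- **Degree bound.** If the clauses of `G` have at most `k` literals, a node has at most `k - 1`
children. [cite: PaturiPudlakSaksZane2005, Lemma 4 ("maximum degree k − 1")] -/
theorem card_children_le (hz : Sat z G) {k : ℕ} (hk : ∀ C ∈ G, C.length ≤ k) {P : Finset V}
    (hP : P.Nonempty) (hPD : Disjoint P Dset) : (pk.children P).card ≤ k - 1 := by
  obtain ⟨l, hl, hlP⟩ := pk.exists_mem_pick_mem hz hP hPD
  have h1 : (cvars (pk.pick P)).card ≤ k :=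
    (List.toFinset_card_le _).trans (by rw [List.length_map]; exact hk _ (pk.pick_mem P hP hPD))
  have h2 : l.1 ∈ cvars (pk.pick P) ∩ P :=
    Finset.mem_inter.2 ⟨List.mem_toFinset.2 (List.mem_map.2 ⟨l, hl, rfl⟩), hlP⟩
  have h3 : (pk.children P).card + (cvars (pk.pick P) ∩ P).card = (cvars (pk.pick P)).card := by
    unfold children; rw [Finset.card_sdiff_add_card_inter]
  have h4 : 1 ≤ (cvars (pk.pick P) ∩ P).card := Finset.card_pos.2 ⟨_, h2⟩
  omega

/-! ### Cut events and the clauses of a subtree -/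

/-- **The cut event** `Cut_T(a)` for the subtree of remaining depth `d` grown at a node with
root-path label set `P`, on placements `α : V → ℕ`: some cut of the subtree consists of variables
placed before `a`. Recursively: every child `w` is placed before `a`, or is a nondefining
variable whose own subtree (path set `insert w P`, depth `d - 1`) has such a cut; a subtree of
depth `0` (a leaf) has no cut; a childless expanded node has the empty cut.
[cite: PaturiPudlakSaksZane2005, §3.3 (Cut_T(r)) with Lemma 11 (defining variables are leaves)] -/
def cutEvent : ℕ → Finset V → (V → ℕ) → ℕ → Prop
  | 0, _, _, _ => False
  | d + 1, P, α, a => ∀ w ∈ pk.children P, α w < a ∨ (w ∉ Dset ∧ cutEvent d (insert w P) α a)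

/-- The clauses picked in the subtree of remaining depth `d` at path set `P` (the clauses
`C_1, …, C_i` of the growing process restricted to that subtree). [cite: PaturiPudlakSaksZane2005, §3.2] -/
noncomputable def clausesOf : ℕ → Finset V → CNF V
  | 0, _ => []
  | d + 1, P => pk.pick P :: ((pk.children P).filter (· ∉ Dset)).toList.flatMap
      fun w => clausesOf d (insert w P)

/-- `(3^d - 1)/2`, the number of internal nodes of a ternary tree of depth `d`: the bound on the
number of picked clauses for `k = 4`. [folklore] -/
def treeSize : ℕ → ℕ
  | 0 => 0
  | d + 1 => 1 + 3 * treeSize d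

/-- `2 · treeSize d + 1 = 3^d`. [folklore] -/
theorem two_mul_treeSize_add_one (d : ℕ) : 2 * treeSize d + 1 = 3 ^ d := by
  induction d with
  | zero => rfl
  | succ d ih => rw [treeSize, pow_succ]; omega

/-- The picked clauses are clauses of `G`. [cite: PaturiPudlakSaksZane2005, §3.2] -/
theorem clausesOf_subset (hz : Sat z G) :
    ∀ (d : ℕ) {P : Finset V}, P.Nonempty → Disjoint P Dset → pk.clausesOf d P ⊆ G
  | 0, _, _, _ => by simp [clausesOf]
  | d + 1, P, hP, hPD => by
    intro C hC
    simp only [clausesOf, List.mem_cons, List.mem_flatMap, Finset.mem_toList,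
      Finset.mem_filter] at hC
    rcases hC with rfl | ⟨w, ⟨hw, hwD⟩, hC⟩
    · exact pk.pick_mem P hP hPD
    · refine clausesOf_subset hz d (Finset.insert_nonempty w P) ?_ hC
      rw [Finset.disjoint_insert_left]; exact ⟨hwD, hPD⟩

/-- **Size bound** (`k = 4`): a subtree of depth `d` picks at most `(3^d-1)/2` clauses.
[cite: PaturiPudlakSaksZane2005, §3.2 ("the total number of nodes … is bounded above by …")] -/
theorem length_clausesOf_le (hz : Sat z G) (h4 : ∀ C ∈ G, C.length ≤ 4) :
    ∀ (d : ℕ) {P : Finset V}, P.Nonempty → Disjoint P Dset →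
      (pk.clausesOf d P).length ≤ treeSize d
  | 0, _, _, _ => by simp [clausesOf, treeSize]
  | d + 1, P, hP, hPD => by
    rw [clausesOf, treeSize, List.length_cons, List.length_flatMap]
    have hc : ((pk.children P).filter (· ∉ Dset)).toList.length ≤ 3 := by
      rw [Finset.length_toList]
      exact (Finset.card_filter_le _ _).trans (pk.card_children_le hz h4 hP hPD)
    have hs : (((pk.children P).filter (· ∉ Dset)).toList.map fun w =>
        (pk.clausesOf d (insert w P)).length).sum ≤
        (((pk.children P).filter (· ∉ Dset)).toList.map fun _ => treeSize d).sum := by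
      apply List.sum_le_sum
      intro w hw
      rw [Finset.mem_toList, Finset.mem_filter] at hw
      refine length_clausesOf_le hz h4 d (Finset.insert_nonempty w P) ?_
      rw [Finset.disjoint_insert_left]; exact ⟨hw.2, hPD⟩
    rw [List.map_const', List.sum_replicate, smul_eq_mul] at hs
    have := Nat.mul_le_mul_right (treeSize d) hc
    have := hs.trans this
    omega

/-! ### The forcing lemma -/

/-- **Semantic core of Lemmas 4/11** (what bounded resolution delivered in PPSZ 2005, proved
here directly): if the cut event of the subtree at `P` holds for the threshold `a`, then every
assignment that satisfies the clauses picked in that subtree and agrees with `z` on all variables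
placed before `a` agrees with `z` on some variable of the path set `P`. (Induction on the depth:
otherwise it agrees with `z ⊕ P` on the variables of `pick P` and falsifies it.)
[cite: PaturiPudlakSaksZane2005, §3.2 (proof of Lemma 4, existence of C(A)) and Lemma 11] -/
theorem sat_clausesOf_forces (hz : Sat z G) :
    ∀ (d : ℕ) {P : Finset V}, P.Nonempty → Disjoint P Dset → ∀ {α : V → ℕ} {a : ℕ},
      pk.cutEvent d P α a → ∀ {b : V → Bool}, Sat b (pk.clausesOf d P) →
        (∀ w, α w < a → b w = z w) → ∃ u ∈ P, b u = z u
  | 0, _, _, _, _, _, h, _, _, _ => by simp [cutEvent] at h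
  | d + 1, P, hP, hPD, α, a, hcut, b, hb, hba => by
    by_contra hcon
    push Not at hcon
    -- `b` agrees with `z` on every child
    have hch : ∀ w ∈ pk.children P, b w = z w := by
      intro w hw
      rcases hcut w hw with h | ⟨hwD, h⟩
      · exact hba w h
      · have hb' : Sat b (pk.clausesOf d (insert w P)) := fun C hC => hb C (by
          simp only [clausesOf, List.mem_cons, List.mem_flatMap, Finset.mem_toList,
            Finset.mem_filter]
          exact Or.inr ⟨w, ⟨hw, hwD⟩, hC⟩)
        have hdis : Disjoint (insert w P) Dset := by
          rw [Finset.disjoint_insert_left]; exact ⟨hwD, hPD⟩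
        obtain ⟨u, hu, hbu⟩ := sat_clausesOf_forces hz d (Finset.insert_nonempty w P) hdis
          h hb' hba
        rcases Finset.mem_insert.1 hu with rfl | hu
        · exact hbu
        · exact absurd hbu (hcon u hu)
    -- hence it agrees with `z ⊕ P` on the variables of the picked clause, which it satisfies
    have hsat : SatClause b (pk.pick P) := hb _ (by simp [clausesOf])
    refine pk.not_sat_pick P hP hPD ((satClause_congr fun l hl => ?_).1 hsat)
    by_cases hlP : l.1 ∈ P
    · have := hcon l.1 hlP
      simp only [flip, hlP, if_true]
      cases hbl : b l.1 <;> cases hzl : z l.1 <;> simp_all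
    · have hlc : l.1 ∈ pk.children P := by
        unfold children cvars
        rw [Finset.mem_sdiff, List.mem_toFinset, List.mem_map]
        exact ⟨⟨l, hl, rfl⟩, hlP⟩
      simp only [flip, hlP, if_false]
      exact hch _ hlc

/-- **Lemma 6 (cuts force), with Lemma 11.** Let `z` satisfy `G`, let `v` be a nondefining
variable, let `α` be placements and `ord` a processing order in which every variable placed
before `α v` precedes `v`. If the cut event of the depth-`d` tree of `v` holds at threshold
`α v`, then `v` is forced for `(G, ord, z)` with implication bound any `D ≥ (3^d-1)/2` (for
clause width `4`). [cite: PaturiPudlakSaksZane2005, Lemma 6 with Lemma 4 / Lemma 11] -/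
theorem isForced_of_cutEvent (hz : Sat z G) (h4 : ∀ C ∈ G, C.length ≤ 4) {v : V}
    (hv : v ∉ Dset) {d D : ℕ} (hD : treeSize d ≤ D) {α : V → ℕ} {ord : List V}
    (hbefore : ∀ w, α w < α v → w ∈ before ord v) (hcut : pk.cutEvent d {v} α (α v)) :
    IsForced G D ord z v := by
  have hP : ({v} : Finset V).Nonempty := Finset.singleton_nonempty v
  have hPD : Disjoint ({v} : Finset V) Dset := Finset.disjoint_singleton_left.2 hv
  refine ⟨pk.clausesOf d {v}, pk.clausesOf_subset hz d hP hPD,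
    (pk.length_clausesOf_le hz h4 d hP hPD).trans hD, fun b hcomp hb => ?_⟩
  rw [compatible_restrict_iff] at hcomp
  obtain ⟨u, hu, hbu⟩ := pk.sat_clausesOf_forces hz d hP hPD hcut hb
    fun w hw => hcomp w (hbefore w hw)
  rw [Finset.mem_singleton] at hu
  rw [← hu]; exact hbu

/-! ### Monotonicity and locality of the cut event -/

/-- The cut event is a down-set in the placements: placing variables earlier keeps it.
[cite: PaturiPudlakSaksZane2005, §3.3 (proof of Lemma 7: "each W_i is an increasing family")] -/
theorem cutEvent_mono : ∀ (d : ℕ) (P : Finset V) {α α' : V → ℕ} {a : ℕ},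
    (∀ w, α' w ≤ α w) → pk.cutEvent d P α a → pk.cutEvent d P α' a
  | 0, _, _, _, _, _, h => h
  | d + 1, P, α, α', a, hle, h => fun w hw => by
    rcases h w hw with h | ⟨hwD, h⟩
    · exact Or.inl ((hle w).trans_lt h)
    · exact Or.inr ⟨hwD, cutEvent_mono d _ hle h⟩

/-- The cut event is increasing in the threshold. [cite: PaturiPudlakSaksZane2005, §3.3] -/
theorem cutEvent_mono_right : ∀ (d : ℕ) (P : Finset V) {α : V → ℕ} {a a' : ℕ},
    a ≤ a' → pk.cutEvent d P α a → pk.cutEvent d P α a'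
  | 0, _, _, _, _, _, h => h
  | d + 1, P, α, a, a', hle, h => fun w hw => by
    rcases h w hw with h | ⟨hwD, h⟩
    · exact Or.inl (h.trans_le hle)
    · exact Or.inr ⟨hwD, cutEvent_mono_right d _ hle h⟩

/-- **Locality (admissibility).** The cut event of the subtree at `P` does not depend on the
placements of the path variables `P` (labels on a root path never reappear below).
[cite: PaturiPudlakSaksZane2005, Def. 1 and §3.3 (proof of Lemma 7: "v_i does not appear elsewhere in T_i")] -/
theorem cutEvent_congr : ∀ (d : ℕ) (P : Finset V) {α α' : V → ℕ} {a : ℕ},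
    (∀ w, w ∉ P → α w = α' w) → (pk.cutEvent d P α a ↔ pk.cutEvent d P α' a)
  | 0, _, _, _, _, _ => Iff.rfl
  | d + 1, P, α, α', a, heq => by
    refine forall₂_congr fun w hw => ?_
    have hwP : w ∉ P := Finset.disjoint_left.1 (pk.disjoint_children P) hw
    rw [heq w hwP]
    refine or_congr Iff.rfl (and_congr Iff.rfl (cutEvent_congr d _ fun u hu => heq u ?_))
    exact fun huP => hu (Finset.mem_insert_of_mem huP)

end Picker

end Grow

end Literature.Computability.FineGrained.PPSZ
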